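import Summits.ResolutionOfSingularities.ResolutionOfSingularities.Theorems.QuotientModelsMinimalHeightTower

/-!
# QuotientModels — MinimalHeight kernels, part 2: one-radical descent and the route-level iffs
(decomp-res lens-4 gen 3)

Continuation of `QuotientModelsMinimalHeightTower.lean` (same provenance: lens-4 node `MinimalHeight`,
land file sha256 3788695a…, split by the route-writer):

* `heightOneDescentAt_iff_simple` : H ⟺ H° (`HeightOneDescentSimpleAt`: ONE radical `L = K(x)`,
  `x ^ p ∈ K`) — the atomic form of the crux, by induction on a finite generating set
  (`exists_frobenius_preimage`, `simple_step`, `descent_of_heightOneDescentSimple`);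
* route level: `regularModels_iff` : `QuotientModels.RegularModels ↔ QuotientModels.PialtModels ∧
  QuotientModels.HeightOneDescent` — the aside RM (27197) is EXACTLY the aside P (27198) plus the
  crux H (27195); `heightOneDescent_iff_simple` : H (27195) ⟺ the aside H° (27696
  `QuotientModels.HeightOneDescentSimple`); `regularModels_iff_simple`; necessity `pieces_of_summit`.
0 sorry.
-/

set_option linter.dupNamespace false

noncomputable section

open CategoryTheory AlgebraicGeometry IsLocalRing
open Literature.AlgebraicGeometry.Resolution

universe u

namespace Summit.ResolutionOfSingularities.ResolutionOfSingularities.Theorems.QuotientModelsMinimalHeight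

/-! ## One-radical descent -/

/-- The Frobenius preimage `{y | y ^ p ∈ E}` of an intermediate field is an intermediate field. -/
theorem exists_frobenius_preimage {K L : Type} [Field K] [Field L] [Algebra K L] (p : ℕ)
    [ExpChar L p] (E : IntermediateField K L) :
    ∃ G : IntermediateField K L, ∀ y : L, y ∈ G ↔ y ^ p ∈ E := by
  let G : Subfield L := E.toSubfield.comap (frobenius L p)
  have hGK : ∀ c : K, algebraMap K L c ∈ G := fun c => by
    change frobenius L p (algebraMap K L c) ∈ E.toSubfield
    rw [frobenius_def, ← map_pow]
    exact E.algebraMap_mem (c ^ p)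
  refine ⟨G.toIntermediateField hGK, fun y => ?_⟩
  change frobenius L p y ∈ E.toSubfield ↔ _
  rw [frobenius_def]
  rfl

/-- `HeightOneDescentAt ⇒ HeightOneDescentSimpleAt`: a simple extension `L = K(x)` with `x ^ p ∈ K`
has `L ^ p ⊆ K` (the Frobenius preimage of `K` is an intermediate field containing `x`). -/
theorem heightOneDescentSimple_of_heightOneDescent {p : ℕ} (hp : p.Prime)
    (h : HeightOneDescentAt p) : HeightOneDescentSimpleAt p := by
  intro k _ _ K L _ _ _ _ _ _ _ _ x hx hgen hN
  haveI : Fact p.Prime := ⟨hp⟩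
  haveI : CharP L p := (Algebra.charP_iff k L p).mp inferInstance
  haveI : ExpChar L p := ExpChar.prime hp
  obtain ⟨G, hG⟩ := exists_frobenius_preimage p (⊥ : IntermediateField K L)
  have hxG : x ∈ G := by
    obtain ⟨c, hc⟩ := RingHom.mem_range.mp hx
    exact (hG x).mpr (IntermediateField.mem_bot.mpr ⟨c, hc⟩)
  have hle : IntermediateField.adjoin K {x} ≤ G :=
    IntermediateField.adjoin_le_iff.mpr (Set.singleton_subset_iff.mpr hxG)
  refine h k K L (fun y => ?_) hN
  have hy : y ∈ IntermediateField.adjoin K {x} := by rw [hgen]; exact IntermediateField.mem_top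
  obtain ⟨c, hc⟩ := IntermediateField.mem_bot.mp ((hG y).mp (hle hy))
  exact RingHom.mem_range.mpr ⟨c, hc⟩

/-- **One SIMPLE descent step between intermediate fields**: `HeightOneDescentSimpleAt` (on types)
applied to `E ≤ E' = E(x)` inside a finite `L/K`, `x ^ p ∈ E`; the generation hypothesis
`E⟮x⟯ = ⊤` is checked through `IntermediateField.lift`. [folklore] -/
theorem simple_step {p : ℕ} (h : HeightOneDescentSimpleAt p) {k K L : Type} [Field k] [CharP k p]
    [Field K] [Field L] [Algebra k K] [Algebra k L] [Algebra K L] [IsScalarTower k K L]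
    [Algebra.EssFiniteType k K] [Module.Finite K L] (E E' : IntermediateField K L) (x : L)
    (hx : x ^ p ∈ E) (hE' : E' = E ⊔ IntermediateField.adjoin K {x})
    (hN : ∃ N : ProperModel k E', Literature.AlgebraicGeometry.Resolution.Scheme.IsRegular N.X) :
    ∃ N : ProperModel k E, Literature.AlgebraicGeometry.Resolution.Scheme.IsRegular N.X := by
  have hle : E ≤ E' := by rw [hE']; exact le_sup_left
  have hxE' : x ∈ E' := by
    rw [hE']
    exact (le_sup_right : IntermediateField.adjoin K {x} ≤ E ⊔ IntermediateField.adjoin K {x})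
      (IntermediateField.subset_adjoin K {x} (Set.mem_singleton x))
  haveI : Algebra.EssFiniteType k E := essFiniteType_intermediateField E
  letI : Algebra E E' := (IntermediateField.inclusion hle).toRingHom.toAlgebra
  haveI : IsScalarTower k E E' := IsScalarTower.of_algebraMap_eq fun x => rfl
  haveI : IsScalarTower K E E' := IsScalarTower.of_algebraMap_eq fun x => rfl
  let f : E' →ₗ[E] L :=
    { toFun := fun x => (x : L)
      map_add' := fun _ _ => rfl
      map_smul' := fun c x => by
        rw [RingHom.id_apply, Algebra.smul_def, RingHom.algebraMap_toAlgebra]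
        rfl }
  haveI : Module.Finite E E' := Module.Finite.of_injective f Subtype.val_injective
  let x' : E' := ⟨x, hxE'⟩
  have hx' : x' ^ p ∈ (algebraMap E E').range := ⟨⟨x ^ p, hx⟩, Subtype.ext rfl⟩
  -- `E'` is generated over `E` by `x'`
  have hgen : IntermediateField.adjoin E {x'} = ⊤ := by
    apply top_le_iff.mp
    intro z _
    let A : IntermediateField E E' := IntermediateField.adjoin E {x'}
    have h1 : E ⊔ IntermediateField.adjoin K {x} ≤ IntermediateField.lift (A.restrictScalars K) := by
      refine sup_le (fun y hy => ?_) (IntermediateField.adjoin_le_iff.mpr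
        (Set.singleton_subset_iff.mpr ((IntermediateField.mem_lift x').mpr
          (IntermediateField.subset_adjoin E {x'} (Set.mem_singleton x')))))
      have hmem : algebraMap E E' ⟨y, hy⟩ ∈ A := A.algebraMap_mem _
      exact (IntermediateField.mem_lift (algebraMap E E' ⟨y, hy⟩)).mpr hmem
    exact (IntermediateField.mem_lift z).mp ((hE'.le.trans h1) z.2)
  exact h k E E' x' hx' hgen hN

/-- **Reduction of height-one descent to SIMPLE steps, inside a finite `L/K`**: a height-one pair
`E₂ ≤ E₁` (`E₁ ^ p ⊆ E₂`) is climbed down one generator at a time,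
`E₁ = E₂(x₁, …, xₘ) ⊇ E₂(x₁, …, xₘ₋₁) ⊇ ⋯ ⊇ E₂`, each step simple of height one (`xᵢ ^ p ∈ E₂`);
induction on a finite generating set (`IntermediateField.fg_of_noetherian`), the top field kept as
an atom with an equation. [folklore] -/
theorem descent_of_heightOneDescentSimple {p : ℕ} (h : HeightOneDescentSimpleAt p) {k K L : Type}
    [Field k] [CharP k p] [Field K] [Field L] [Algebra k K] [Algebra k L] [Algebra K L]
    [IsScalarTower k K L] [Algebra.EssFiniteType k K] [Module.Finite K L]
    (E₁ E₂ : IntermediateField K L) (hle : E₂ ≤ E₁) (hfrob : ∀ x : L, x ∈ E₁ → x ^ p ∈ E₂)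
    (hN : ∃ N : ProperModel k E₁, Literature.AlgebraicGeometry.Resolution.Scheme.IsRegular N.X) :
    ∃ N : ProperModel k E₂, Literature.AlgebraicGeometry.Resolution.Scheme.IsRegular N.X := by
  classical
  have key : ∀ (s : Finset L) (E E' : IntermediateField K L),
      E' = E ⊔ IntermediateField.adjoin K (s : Set L) → (∀ x ∈ s, x ^ p ∈ E) →
      (∃ N : ProperModel k E', Literature.AlgebraicGeometry.Resolution.Scheme.IsRegular N.X) →
      ∃ N : ProperModel k E, Literature.AlgebraicGeometry.Resolution.Scheme.IsRegular N.X := by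
    intro s
    induction s using Finset.induction_on with
    | empty =>
        intro E E' hE' _ hN
        obtain ⟨N, hN⟩ := hN
        have hE : E' = E := by
          rw [hE', Finset.coe_empty, IntermediateField.adjoin_empty, sup_bot_eq]
        let eqv : ↥E' ≃ₐ[k] ↥E := (IntermediateField.equivOfEq hE).restrictScalars k
        exact ⟨N.ofAlgEquiv eqv, hN⟩
    | insert x s hxs ih =>
        intro E E' hE' hs hN
        have hxE : x ^ p ∈ E := hs x (Finset.mem_insert_self x s)
        have hE'' : E' = (E ⊔ IntermediateField.adjoin K {x}) ⊔
            IntermediateField.adjoin K (s : Set L) := by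
          rw [hE', Finset.coe_insert, Set.insert_eq, IntermediateField.adjoin_union, sup_assoc]
        have hEle : E ≤ E ⊔ IntermediateField.adjoin K {x} := le_sup_left
        have hs' : ∀ y ∈ s, y ^ p ∈ E ⊔ IntermediateField.adjoin K {x} := fun y hy =>
          SetLike.le_def.mp hEle (hs y (Finset.mem_insert_of_mem hy))
        obtain ⟨N', hN'⟩ := ih (E ⊔ IntermediateField.adjoin K {x}) E' hE'' hs' hN
        exact simple_step h E (E ⊔ IntermediateField.adjoin K {x}) x hxE rfl ⟨N', hN'⟩
  obtain ⟨s, hs⟩ := E₁.fg_of_noetherian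
  have hE₁ : E₁ = E₂ ⊔ IntermediateField.adjoin K (s : Set L) := by
    rw [hs]; exact (sup_eq_right.mpr hle).symm
  refine key s E₂ E₁ hE₁ (fun x hxs => hfrob x ?_) hN
  rw [← hs]
  exact IntermediateField.subset_adjoin K (s : Set L) hxs

/-- `HeightOneDescentSimpleAt ⇒ HeightOneDescentAt` (types): pass to the pair `⊥ ≤ ⊤` of intermediate
fields of `L/K` and transport along `L ≃ ⊤`, `⊥ ≃ K`. -/
theorem heightOneDescent_of_heightOneDescentSimple {p : ℕ} (h : HeightOneDescentSimpleAt p) :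
    HeightOneDescentAt p := by
  intro k _ _ K L _ _ _ _ _ _ _ _ hexp hN
  obtain ⟨N, hN⟩ := hN
  have hfrob : ∀ x : L, x ∈ (⊤ : IntermediateField K L) → x ^ p ∈ (⊥ : IntermediateField K L) :=
    fun x _ => by
      obtain ⟨c, hc⟩ := RingHom.mem_range.mp (hexp x)
      exact IntermediateField.mem_bot.mpr ⟨c, hc⟩
  let eT : L ≃ₐ[k] (⊤ : IntermediateField K L) :=
    (IntermediateField.topEquiv (F := K) (E := L)).symm.restrictScalars k
  obtain ⟨N₀, hN₀⟩ := descent_of_heightOneDescentSimple h (⊤ : IntermediateField K L) ⊥ le_top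
    hfrob ⟨N.ofAlgEquiv eT, hN⟩
  let eB : (⊥ : IntermediateField K L) ≃ₐ[k] K := (IntermediateField.botEquiv K L).restrictScalars k
  exact ⟨N₀.ofAlgEquiv eB, hN₀⟩

/-- **`HeightOneDescentAt p ⟺ HeightOneDescentSimpleAt p`.** -/
theorem heightOneDescentAt_iff_simple {p : ℕ} (hp : p.Prime) :
    HeightOneDescentAt p ↔ HeightOneDescentSimpleAt p :=
  ⟨heightOneDescentSimple_of_heightOneDescent hp, heightOneDescent_of_heightOneDescentSimple⟩

/-- **Exact bisection, simple form**: `RegModel p ⟺ PialtModelsAt p ∧ HeightOneDescentSimpleAt p`. -/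
theorem regModel_iff_simple {p : ℕ} (hp : p.Prime) :
    ProperModel.RegModel.{0} p ↔ PialtModelsAt p ∧ HeightOneDescentSimpleAt p := by
  rw [regModel_iff hp, heightOneDescentAt_iff_simple hp]

/-! ## Route-level statements (items of `Theses/QuotientModels.lean`, wrapped over all primes) -/

/-- Unfolding of the aside H° (item 27696, `QuotientModels.HeightOneDescentSimple`) into its per-prime
body. -/
theorem heightOneDescentSimple_iff_at :
    Theses.QuotientModels.HeightOneDescentSimple ↔ ∀ p : ℕ, p.Prime → HeightOneDescentSimpleAt p :=
  Iff.rfl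

/-- Unfolding of the aside P (27198) into its per-prime body. -/
theorem pialtModels_iff_at :
    Theses.QuotientModels.PialtModels ↔ ∀ p : ℕ, p.Prime → PialtModelsAt p := Iff.rfl

/-- Unfolding of the crux H (27195) into its per-prime body. -/
theorem heightOneDescent_iff_at :
    Theses.QuotientModels.HeightOneDescent ↔ ∀ p : ℕ, p.Prime → HeightOneDescentAt p := Iff.rfl

/-- Unfolding of the aside RM (27197): `RegularModels = ∀ p prime, ProperModel.RegModel p`. -/
theorem regularModels_iff_at :
    Theses.QuotientModels.RegularModels ↔
      ∀ p : ℕ, p.Prime → Literature.AlgebraicGeometry.Resolution.ProperModel.RegModel.{0} p :=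
  Iff.rfl

/-- RM ⇒ P (take `L := K`). -/
theorem pialtModels_of_regularModels (h : Theses.QuotientModels.RegularModels) :
    Theses.QuotientModels.PialtModels :=
  fun p hp => pialtModels_of_regModel (h p hp)

/-- RM ⇒ H (ignore the extension). -/
theorem heightOneDescent_of_regularModels (h : Theses.QuotientModels.RegularModels) :
    Theses.QuotientModels.HeightOneDescent :=
  fun p hp => heightOneDescent_of_regModel (h p hp)

/-- **P ∧ H ⇒ RM** (the Frobenius tower, all ground fields, no Galois tower). -/
theorem regularModels_of_pialtModels_of_heightOneDescent (hP : Theses.QuotientModels.PialtModels)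
    (hD : Theses.QuotientModels.HeightOneDescent) : Theses.QuotientModels.RegularModels :=
  fun p hp => regModel_of_pialtModels_of_heightOneDescent hp (hP p hp) (hD p hp)

/-- **`RegularModels ⟺ PialtModels ∧ HeightOneDescent`** (asides RM = P ∧ crux H, exactly). -/
theorem regularModels_iff :
    Theses.QuotientModels.RegularModels ↔
      Theses.QuotientModels.PialtModels ∧ Theses.QuotientModels.HeightOneDescent :=
  ⟨fun h => ⟨pialtModels_of_regularModels h, heightOneDescent_of_regularModels h⟩,
    fun h => regularModels_of_pialtModels_of_heightOneDescent h.1 h.2⟩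

/-- **`HeightOneDescent ⟺ HeightOneDescentSimple`** (WLOG one radical). -/
theorem heightOneDescent_iff_simple :
    Theses.QuotientModels.HeightOneDescent ↔ Theses.QuotientModels.HeightOneDescentSimple :=
  ⟨fun h p hp => (heightOneDescentAt_iff_simple hp).mp (h p hp),
    fun h p hp => (heightOneDescentAt_iff_simple hp).mpr (h p hp)⟩

/-- `RegularModels ⟺ PialtModels ∧ HeightOneDescentSimple`. -/
theorem regularModels_iff_simple :
    Theses.QuotientModels.RegularModels ↔
      Theses.QuotientModels.PialtModels ∧ Theses.QuotientModels.HeightOneDescentSimple := by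
  rw [regularModels_iff, heightOneDescent_iff_simple]

/-- Necessity of every piece from the summit. -/
theorem pieces_of_summit (h : _root_.ResolutionOfSingularities) :
    Theses.QuotientModels.RegularModels ∧ Theses.QuotientModels.PialtModels ∧
      Theses.QuotientModels.HeightOneDescent ∧ Theses.QuotientModels.HeightOneDescentSimple := by
  have hR : Theses.QuotientModels.RegularModels := fun p hp =>
    ProperModel.regModel_of_resolutionInChar ((ResolutionOfSingularities_iff.mp h) p hp)
  exact ⟨hR, pialtModels_of_regularModels hR, heightOneDescent_of_regularModels hR,
    heightOneDescent_iff_simple.mp (heightOneDescent_of_regularModels hR)⟩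

end Summit.ResolutionOfSingularities.ResolutionOfSingularities.Theorems.QuotientModelsMinimalHeight

end

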